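import Summits.QuantumFields.YangMills.Theorems.ParabolicTrajectoryTunedSequenceExistsMirrorGlue
import Summits.QuantumFields.YangMills.Theorems.ParabolicTrajectoryTunedSequenceExistsUniformFreezing

/-!
# Crux `TunedSequenceExists` (stmt-QuantumFields-10524), line `fixed-aspect-window`:
# the WEAKEST COMPOSING FORMS of (U) and (V) — `FemtoLowerBound` (U_∃h) and `VolumeMonotoneSlack`
# (V_slack) — definitions, the old ⇒ new implications, the composition, free corners, certificates
# (lead c6 reshape, 2026-08-17)

Notation: `u(β, m, L) := (M^m)⁸ ⟨P ; τ_{M^m} P⟩_{β, 2L+1}`, `P = r.curvature.F`, `D := M^m`.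

The registered split (`…SplitDefs`, p137427) composes (U) `FemtoWindow` (height `c / log² L₁` at the
pinned aspect `L₁`) with (V) `VolumeMonotone` (additive tolerance `c / log² L₁` for EVERY `c > 0`).  Two
observations of this reshape:

* The composition `lowerBound_of_femto_of_volume` never uses the RATE `1 / log² L₁`: it needs, at ONE
  aspect `L₁` beyond both floors, SOME positive height `h` from (U) and a volume comparison whose loss
  is below `h`.  The weakest (U) that composes is therefore **(U_∃h) `FemtoLowerBound`**: for every
  aspect `L₁ ≥ LU` there is `h > 0` (depending on `L₁`, no rate) with `h ≤ u(β, m, L₁ M^m)` beyond every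
  coupling/depth floor.  `FemtoWindow r M → FemtoLowerBound r M` (`femtoLowerBound_of_femtoWindow`).
* The additive `∀ c` tolerance of (V) makes it, between two FEMTO tori (both sides of size `≍ 1/log² L₁`
  at the relevant physical separations), a statement of RELATIVE PRECISION → 0, i.e. two-sided UV
  asymptotics — not thermodynamic-limit content (a bracket `c Γ ≤ u ≤ C Γ` of the sibling crux
  stmt-QuantumFields-16204 gives the comparison up to the factor `C/c`, never to precision `o(Γ)`).  The
  constant-factor-plus-slack form **(V_slack) `VolumeMonotoneSlack`**:
  `∃ K > 0, ∃ LV, ∀ L₁ ≥ LV, ∀ ε > 0, ∃ β₁ m₁, ∀ β ≥ β₁, m ≥ m₁, L ≥ L₁ M^m: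
  u(β, m, L₁ M^m) ≤ K · u(β, m, L) + ε` composes with (U_∃h) (`ε := h/2`, `θ₀ := h/(2K)`,
  `lowerBound_of_femtoLower_of_volumeSlack`), is implied by the purely relative form (`ε` unused), has
  FREE frozen corners (`volumeSlack_of_depth_le`: bounded depth, all volumes, by uniform two-point
  freezing) and, for the time-zero plaquette `Q`, a free femto–femto corner (`QFemto.rescaledQ_femto_volume_ratio`,
  `K = C/c`).  Its content is the comparison of a bounded-physical-size torus with arbitrarily large ones
  at physical separations in a compact band — the thermodynamic limit proper.

Glue (sorry-free): `tunedSequenceExists_of_slack_subs : FemtoLowerBoundAll → VolumeMonotoneSlackAll →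
CanonicalUpperBoundAll → TunedSequenceExists` and the four-child mirror version
`tunedSequenceExists_of_slack_mirror_subs` (with `MirrorBoundInAll`, `MirrorBoundOutAll`, via the landed
`MirrorBound.canonicalUpperBoundAll_of_mirror`).  Certificates: (V_slack) is inhabited by the zero table;
(U_∃h) is inhabited by an aspect-decaying table for which the core's shape fails — neither is ≥ the core
`CorrelatorWindowLowerBound`.  The statements are OBLIGATION PIECES of our crux (bodies of the reshaped
stubs `stub_femtoLowerBound` / `stub_volumeSlack` of `Cruxes/TunedSequenceExists/Lines/fixed_aspect_window.lean`),
not published facts.  References: Lüscher 1983/1986 (finite-size effects), Osterwalder–Seiler 1978 §2.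
-/

noncomputable section

open Filter Topology MeasureTheory
open Literature.MathematicalPhysics.QuantumFieldTheory Literature.MathematicalPhysics.QuantumLattice

namespace Summit.QuantumFields.YangMills.Theorems.TunedSequenceExists.FixedAspectSplit

/-! ## §1 The two reshaped sub-statements at fixed data `(G, r, M)` -/

section Statements

variable {G : Type} [Group G] [TopologicalSpace G] [IsTopologicalGroup G] [CompactSpace G]
  [MeasurableSpace G] [BorelSpace G]

/-- **(U_∃h) The pinned-aspect window with an existential positive height.**  There is an aspect
floor `LU` such that for every aspect `L₁ ≥ LU` SOME `h > 0` (depending on `L₁`; no rate asked) bounds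
`u(β, m, L₁ M^m)` from below beyond every coupling floor `B` and depth floor `m₀`.  Obligation piece of
the crux (reshaped stub `stub_femtoLowerBound`); not a published fact. -/
def FemtoLowerBound (r : LatticeRep G) (M : ℕ) : Prop :=
  ∃ LU : ℕ, ∀ L₁ : ℕ, LU ≤ L₁ → ∃ h : ℝ, 0 < h ∧ ∀ (B : ℝ) (m₀ : ℕ),
    ∃ m : ℕ, m₀ ≤ m ∧ ∃ β : ℝ, B ≤ β ∧
      h ≤ ((M : ℝ) ^ m) ^ 8 *
        latticeConnectedCorr r.ρ β (2 * (L₁ * M ^ m) + 1) r.curvature.F r.curvature.F (M ^ m)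

/-- **(V_slack) Constant-factor-plus-slack volume comparison at weak coupling.**  There are a factor
`K > 0` and an aspect floor `LV` such that for every aspect `L₁ ≥ LV` and every slack `ε > 0` there are
`β₁, m₁` with `u(β, m, L₁ M^m) ≤ K · u(β, m, L) + ε` for all `β ≥ β₁`, `m ≥ m₁` and ALL `L ≥ L₁ M^m`.
Obligation piece of the crux (reshaped stub `stub_volumeSlack`); not a published fact. -/
def VolumeMonotoneSlack (r : LatticeRep G) (M : ℕ) : Prop :=
  ∃ K : ℝ, 0 < K ∧ ∃ LV : ℕ, ∀ L₁ : ℕ, LV ≤ L₁ → ∀ ε : ℝ, 0 < ε → ∃ (β₁ : ℝ) (m₁ : ℕ),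
    ∀ (β : ℝ) (m L : ℕ), β₁ ≤ β → m₁ ≤ m → L₁ * M ^ m ≤ L →
      ((M : ℝ) ^ m) ^ 8 *
          latticeConnectedCorr r.ρ β (2 * (L₁ * M ^ m) + 1) r.curvature.F r.curvature.F (M ^ m) ≤
        K * (((M : ℝ) ^ m) ^ 8 *
          latticeConnectedCorr r.ρ β (2 * L + 1) r.curvature.F r.curvature.F (M ^ m)) + ε

end Statements

/-- **(U_∃h) under the crux's quantifier prefix** (body of the reshaped stub `stub_femtoLowerBound`). -/
def FemtoLowerBoundAll : Prop :=
  ∀ (G : Type) [Group G] [TopologicalSpace G] [IsTopologicalGroup G] [CompactSpace G],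
    IsCompactSimpleLieGroup G → letI : MeasurableSpace G := borel G
    haveI : BorelSpace G := ⟨rfl⟩
    ∀ (r : LatticeRep G) (M : ℕ), 2 ≤ M → FemtoLowerBound r M

/-- **(V_slack) under the crux's quantifier prefix** (body of the reshaped stub `stub_volumeSlack`). -/
def VolumeMonotoneSlackAll : Prop :=
  ∀ (G : Type) [Group G] [TopologicalSpace G] [IsTopologicalGroup G] [CompactSpace G],
    IsCompactSimpleLieGroup G → letI : MeasurableSpace G := borel G
    haveI : BorelSpace G := ⟨rfl⟩
    ∀ (r : LatticeRep G) (M : ℕ), 2 ≤ M → VolumeMonotoneSlack r M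

/-! ## §2 The registered forms imply the reshaped ones -/

section OldToNew

variable {G : Type} [Group G] [TopologicalSpace G] [IsTopologicalGroup G] [CompactSpace G]
  [MeasurableSpace G] [BorelSpace G]

/-- **(U) ⇒ (U_∃h)**: the registered `FemtoWindow` (height `c / log² L₁`) implies `FemtoLowerBound`
(take `h := c / log² L₁ > 0` at each aspect `L₁ ≥ max LU 2`). [folklore] -/
theorem femtoLowerBound_of_femtoWindow (r : LatticeRep G) {M : ℕ} (h : FemtoWindow r M) :
    FemtoLowerBound r M := by
  obtain ⟨c, hc, LU, hU⟩ := h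
  refine ⟨max LU 2, fun L₁ hL₁ => ?_⟩
  have hLU : LU ≤ L₁ := (le_max_left _ _).trans hL₁
  have h2 : 2 ≤ L₁ := (le_max_right _ _).trans hL₁
  have hlog : 0 < Real.log (L₁ : ℝ) := Real.log_pos (by exact_mod_cast h2)
  exact ⟨c / Real.log L₁ ^ 2, by positivity, fun B m₀ => hU L₁ hLU h2 B m₀⟩

/-- (U) ⇒ (U_∃h) under the crux prefix. [folklore] -/
theorem femtoLowerBoundAll_of_femtoWindowAll (h : FemtoWindowAll) : FemtoLowerBoundAll := by
  intro G _ _ _ _ hG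
  letI : MeasurableSpace G := borel G
  haveI : BorelSpace G := ⟨rfl⟩
  intro r M hM
  exact femtoLowerBound_of_femtoWindow r (h G hG r M hM)

/-- **Purely relative ⇒ slack**: a constant-factor comparison `u(small) ≤ K · u(big)` (the shape of the
Q-kit child `QFemto.VolumeMonotoneQRel`, here for `P`) implies `VolumeMonotoneSlack` (the slack is
unused). [folklore] -/
theorem volumeMonotoneSlack_of_rel (r : LatticeRep G) {M : ℕ}
    (h : ∃ K : ℝ, 0 < K ∧ ∃ LV : ℕ, ∀ L₁ : ℕ, LV ≤ L₁ → ∃ (β₁ : ℝ) (m₁ : ℕ),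
      ∀ (β : ℝ) (m L : ℕ), β₁ ≤ β → m₁ ≤ m → L₁ * M ^ m ≤ L →
        ((M : ℝ) ^ m) ^ 8 *
            latticeConnectedCorr r.ρ β (2 * (L₁ * M ^ m) + 1) r.curvature.F r.curvature.F (M ^ m) ≤
          K * (((M : ℝ) ^ m) ^ 8 *
            latticeConnectedCorr r.ρ β (2 * L + 1) r.curvature.F r.curvature.F (M ^ m))) :
    VolumeMonotoneSlack r M := by
  obtain ⟨K, hK, LV, hV⟩ := h
  refine ⟨K, hK, LV, fun L₁ hL₁ ε hε => ?_⟩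
  obtain ⟨β₁, m₁, hV'⟩ := hV L₁ hL₁
  exact ⟨β₁, m₁, fun β m L hβ hm hL => by linarith [hV' β m L hβ hm hL]⟩

end OldToNew

/-! ## §3 Glue (sorry-free): (U_∃h) + (V_slack) ⇒ the core; with (A) or the mirror bounds ⇒ the crux -/

section Glue

variable {G : Type} [Group G] [TopologicalSpace G] [IsTopologicalGroup G] [CompactSpace G]
  [MeasurableSpace G] [BorelSpace G]

/-- **(U_∃h) + (V_slack) ⇒ the finite-volume correlator window lower bound** (the crux core
`CorrelatorWindowLowerBound`) with `θ₀ = h / (2K)`: fix the aspect `L₁ = max LU LV` BEFORE the floors,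
read the height `h(L₁)` of (U_∃h), run (V_slack) with slack `ε = h/2`. Pure quantifier arithmetic. -/
theorem lowerBound_of_femtoLower_of_volumeSlack (r : LatticeRep G) {M : ℕ}
    (hU : FemtoLowerBound r M) (hV : VolumeMonotoneSlack r M) :
    ∃ θ₀ : ℝ, 0 < θ₀ ∧ ∀ (B : ℝ) (m₀ L₀ : ℕ), ∃ m : ℕ, m₀ ≤ m ∧ ∃ L : ℕ, L₀ * M ^ m ≤ L ∧
      ∃ β : ℝ, B ≤ β ∧ θ₀ ≤ ((M : ℝ) ^ m) ^ 8 *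
        latticeConnectedCorr r.ρ β (2 * L + 1) r.curvature.F r.curvature.F (M ^ m) := by
  obtain ⟨LU, hU⟩ := hU
  obtain ⟨K, hK, LV, hV⟩ := hV
  set L₁ : ℕ := max LU LV with hL₁
  obtain ⟨h, hh, hU'⟩ := hU L₁ (le_max_left _ _)
  obtain ⟨β₁, m₁, hV'⟩ := hV L₁ (le_max_right _ _) (h / 2) (half_pos hh)
  refine ⟨h / (2 * K), by positivity, fun B m₀ L₀ => ?_⟩
  obtain ⟨m, hm, β, hβ, hu⟩ := hU' (max B β₁) (max m₀ m₁)
  refine ⟨m, (le_max_left _ _).trans hm, max L₀ L₁ * M ^ m,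
    Nat.mul_le_mul_right _ (le_max_left _ _), β, (le_max_left _ _).trans hβ, ?_⟩
  have hstep := hV' β m (max L₀ L₁ * M ^ m) ((le_max_right _ _).trans hβ)
    ((le_max_right _ _).trans hm) (Nat.mul_le_mul_right _ (le_max_right _ _))
  rw [div_le_iff₀ (by positivity : (0 : ℝ) < 2 * K)]
  nlinarith

/-- **The crux body at fixed `(G, r, M)`, `M ≥ 2`, from (U_∃h), (V_slack), (A)**: lower bound
(`lowerBound_of_femtoLower_of_volumeSlack`) ⇒ weak window with EXACT tuning (landed
`Negative.Glue.weak_of_lowerBound`) ⇒ a-priori bound (`bounded_of_canonicalUpperBound`) ⇒ diagonal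
extraction (`witness_of_bounded`). -/
theorem window_of_slack_subs (r : LatticeRep G) {M : ℕ} (hM : 2 ≤ M) (hU : FemtoLowerBound r M)
    (hV : VolumeMonotoneSlack r M) (hA : CanonicalUpperBound r) :
    ∃ θ₀ : ℝ, 0 < θ₀ ∧ ∀ θ : ℝ, 0 < θ → θ < θ₀ →
      ∃ (sch : SpeciesScheme (YMSpecies G)) (n : ℕ → ℕ),
        (∀ k, sch.a k = ((M : ℝ) ^ n k)⁻¹) ∧ Tendsto sch.β atTop atTop ∧
        (∀ t : ℕ, 0 < t → ∃ c : ℝ, Tendsto (fun k => ((M : ℝ) ^ n k) ^ 8 *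
            latticeConnectedCorr r.ρ (sch.β k) (sch.side k) r.curvature.F r.curvature.F
              (t * M ^ n k)) atTop (𝓝 c)) ∧
        Tendsto (fun k => ((M : ℝ) ^ n k) ^ 8 *
            latticeConnectedCorr r.ρ (sch.β k) (sch.side k) r.curvature.F r.curvature.F
              (M ^ n k)) atTop (𝓝 θ) := by
  obtain ⟨θ₀, hθ₀, hweak⟩ :=
    Negative.Glue.weak_of_lowerBound r hM (lowerBound_of_femtoLower_of_volumeSlack r hU hV)
  refine ⟨θ₀, hθ₀, fun θ hθ hθ' => ?_⟩
  obtain ⟨sch, n, hshape, hβ, hlim⟩ := hweak θ hθ hθ'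
  exact witness_of_bounded r M θ sch n hshape hβ
    (fun t ht => bounded_of_canonicalUpperBound r hA sch n hshape hβ t ht) hlim

end Glue

/-- **Three-child split glue on the reshaped names**: `FemtoLowerBoundAll → VolumeMonotoneSlackAll →
CanonicalUpperBoundAll → Summit.QuantumFields.YangMills.Theses.ParabolicTrajectory.TunedSequenceExists`
(sorry-free). -/
theorem tunedSequenceExists_of_slack_subs (hU : FemtoLowerBoundAll) (hV : VolumeMonotoneSlackAll)
    (hA : CanonicalUpperBoundAll) :
    Summit.QuantumFields.YangMills.Theses.ParabolicTrajectory.TunedSequenceExists := by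
  intro G _ _ _ _ hG
  letI : MeasurableSpace G := borel G
  haveI : BorelSpace G := ⟨rfl⟩
  intro r M hM
  exact window_of_slack_subs r hM (hU G hG r M hM) (hV G hG r M hM) (hA G hG r)

/-- **Four-child split glue on the reshaped names** (the `--glue-by` declaration of the reshaped line):
`FemtoLowerBoundAll → VolumeMonotoneSlackAll → MirrorBoundInAll → MirrorBoundOutAll →
Summit.QuantumFields.YangMills.Theses.ParabolicTrajectory.TunedSequenceExists` — mirror glue (landed,
odd-torus reflection positivity + Cauchy–Schwarz) ⇒ (A), then the three-child glue.
[cite: OsterwalderSeiler1978, §2] -/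
theorem tunedSequenceExists_of_slack_mirror_subs (hU : FemtoLowerBoundAll)
    (hV : VolumeMonotoneSlackAll) (hIn : MirrorBoundInAll) (hOut : MirrorBoundOutAll) :
    Summit.QuantumFields.YangMills.Theses.ParabolicTrajectory.TunedSequenceExists :=
  tunedSequenceExists_of_slack_subs hU hV (MirrorBound.canonicalUpperBoundAll_of_mirror hIn hOut)

/-- The registered three-child hypotheses still close the crux through the reshaped glue (consistency:
the reshape loses nothing on the (U) side). -/
example (hU : FemtoWindowAll) (hV : VolumeMonotoneSlackAll) (hA : CanonicalUpperBoundAll) :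
    Summit.QuantumFields.YangMills.Theses.ParabolicTrajectory.TunedSequenceExists :=
  tunedSequenceExists_of_slack_subs (femtoLowerBoundAll_of_femtoWindowAll hU) hV hA

/-! ## §4 Free corners of (V_slack): bounded depth (uniform freezing) -/

section FreeCorners

variable {G : Type} [Group G] [TopologicalSpace G] [IsTopologicalGroup G] [CompactSpace G]
  [MeasurableSpace G] [BorelSpace G]

/-- **The slack inequality is automatic where both rescaled correlators are small**: if
`|u(small)| ≤ ε/2` and `|u(big)| ≤ ε/(2K)` then `u(small) ≤ K · u(big) + ε` (`K > 0`). [folklore] -/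
theorem slack_of_abs_le {K ε us ub : ℝ} (hK : 0 < K) (hs : |us| ≤ ε / 2) (hb : |ub| ≤ ε / (2 * K)) :
    us ≤ K * ub + ε := by
  have h1 := (abs_le.1 hs).2
  have h2 := (abs_le.1 hb).1
  have h3 : K * (-(ε / (2 * K))) ≤ K * ub := mul_le_mul_of_nonneg_left h2 hK.le
  have h4 : K * (-(ε / (2 * K))) = -(ε / 2) := by field_simp
  linarith

/-- **(V_slack) at bounded depth is free, for EVERY factor `K > 0`.**  For every aspect `L₁`, slack
`ε > 0` and depth CAP `m̄` there is `β₁` such that for all `β ≥ β₁`, all `m ≤ m̄` and ALL half-sides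
`L` the slack inequality holds — both rescaled correlators are uniformly small by volume-uniform
two-point freezing (`UniformFreezing.uniform_twoPoint_freezing_rep`).  So the content of (V_slack) is
the joint tail `m → ∞` at `β ≥ β₁`, exactly as for the registered (V). [folklore] -/
theorem volumeSlack_of_depth_le (r : LatticeRep G) (M : ℕ) {K : ℝ} (hK : 0 < K) (L₁ : ℕ) {ε : ℝ}
    (hε : 0 < ε) (mbar : ℕ) :
    ∃ β₁ : ℝ, ∀ (β : ℝ) (m L : ℕ), β₁ ≤ β → m ≤ mbar →
      ((M : ℝ) ^ m) ^ 8 *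
          latticeConnectedCorr r.ρ β (2 * (L₁ * M ^ m) + 1) r.curvature.F r.curvature.F (M ^ m) ≤
        K * (((M : ℝ) ^ m) ^ 8 *
          latticeConnectedCorr r.ρ β (2 * L + 1) r.curvature.F r.curvature.F (M ^ m)) + ε := by
  set Kbar : ℝ := ((max (M : ℝ) 1) ^ mbar) ^ 8 with hKbar
  have hK1 : 1 ≤ max (M : ℝ) 1 := le_max_right _ _
  have hKpos : 0 < Kbar := by positivity
  have hpow : ∀ m : ℕ, m ≤ mbar → ((M : ℝ) ^ m) ^ 8 ≤ Kbar := fun m hm => by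
    have h1 : (M : ℝ) ^ m ≤ (max (M : ℝ) 1) ^ m :=
      pow_le_pow_left₀ (Nat.cast_nonneg _) (le_max_left _ _) _
    have h2 : (max (M : ℝ) 1) ^ m ≤ (max (M : ℝ) 1) ^ mbar := pow_le_pow_right₀ hK1 hm
    exact pow_le_pow_left₀ (by positivity) (h1.trans h2) _
  -- the target smallness `δ := ε / (2 (K + 1))` serves both sides (`δ ≤ ε/2` and `δ ≤ ε/(2K)`)
  set δ : ℝ := ε / (2 * (K + 1)) with hδ
  have hδpos : 0 < δ := by positivity
  obtain ⟨β₀, -, h⟩ := UniformFreezing.uniform_twoPoint_freezing_rep r (show 0 < δ / Kbar by positivity)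
  refine ⟨β₀, fun β m L hβ hm => ?_⟩
  have hsmall := h β hβ (2 * (L₁ * M ^ m) + 1) (M ^ m)
  have hbig := h β hβ (2 * L + 1) (M ^ m)
  have hval : Kbar * (δ / Kbar) = δ := by field_simp
  have hbd : ∀ {x : ℝ}, |x| ≤ δ / Kbar → |((M : ℝ) ^ m) ^ 8 * x| ≤ δ := fun {x} hx => by
    rw [abs_mul, abs_of_nonneg (by positivity : (0 : ℝ) ≤ ((M : ℝ) ^ m) ^ 8), ← hval]
    exact mul_le_mul (hpow m hm) hx (abs_nonneg _) hKpos.le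
  have hδ1 : δ ≤ ε / 2 := by
    rw [hδ, div_le_div_iff₀ (by positivity) (by positivity)]
    nlinarith
  have hδ2 : δ ≤ ε / (2 * K) := by
    rw [hδ, div_le_div_iff₀ (by positivity) (by positivity)]
    nlinarith
  exact slack_of_abs_le hK ((hbd hsmall).trans hδ1) ((hbd hbig).trans hδ2)

/-- **The depth floor `m₁` of (V_slack) is idle**: `VolumeMonotoneSlack r M` is equivalent to its
variant with `∀ m`. [folklore] -/
theorem volumeMonotoneSlack_iff_allDepths (r : LatticeRep G) (M : ℕ) :
    VolumeMonotoneSlack r M ↔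
      ∃ K : ℝ, 0 < K ∧ ∃ LV : ℕ, ∀ L₁ : ℕ, LV ≤ L₁ → ∀ ε : ℝ, 0 < ε → ∃ β₁ : ℝ,
        ∀ (β : ℝ) (m L : ℕ), β₁ ≤ β → L₁ * M ^ m ≤ L →
          ((M : ℝ) ^ m) ^ 8 *
              latticeConnectedCorr r.ρ β (2 * (L₁ * M ^ m) + 1) r.curvature.F r.curvature.F (M ^ m) ≤
            K * (((M : ℝ) ^ m) ^ 8 *
              latticeConnectedCorr r.ρ β (2 * L + 1) r.curvature.F r.curvature.F (M ^ m)) + ε := by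
  constructor
  · rintro ⟨K, hK, LV, hLV⟩
    refine ⟨K, hK, LV, fun L₁ h1 ε hε => ?_⟩
    obtain ⟨β₁, m₁, hV⟩ := hLV L₁ h1 ε hε
    obtain ⟨β₁', hD⟩ := volumeSlack_of_depth_le r M hK L₁ hε m₁
    refine ⟨max β₁ β₁', fun β m L hβ hL => ?_⟩
    rcases le_or_gt m₁ m with hm | hm
    · exact hV β m L ((le_max_left _ _).trans hβ) hm hL
    · exact hD β m L ((le_max_right _ _).trans hβ) hm.le
  · rintro ⟨K, hK, LV, hLV⟩
    refine ⟨K, hK, LV, fun L₁ h1 ε hε => ?_⟩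
    obtain ⟨β₁, hV⟩ := hLV L₁ h1 ε hε
    exact ⟨β₁, 0, fun β m L hβ _ hL => hV β m L hβ hL⟩

end FreeCorners

/-! ## §5 Size certificates (kernel-checked): neither reshaped statement is the crux core -/

section Certificates

/-- Shape of (U_∃h) for an abstract table `u : ℝ → ℕ → ℕ → ℝ` (coupling, depth, half-side). -/
def FemtoLowerBoundShape (u : ℝ → ℕ → ℕ → ℝ) (M : ℕ) : Prop :=
  ∃ LU : ℕ, ∀ L₁ : ℕ, LU ≤ L₁ → ∃ h : ℝ, 0 < h ∧ ∀ (B : ℝ) (m₀ : ℕ),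
    ∃ m : ℕ, m₀ ≤ m ∧ ∃ β : ℝ, B ≤ β ∧ h ≤ u β m (L₁ * M ^ m)

/-- Shape of (V_slack) for an abstract table. -/
def VolumeMonotoneSlackShape (u : ℝ → ℕ → ℕ → ℝ) (M : ℕ) : Prop :=
  ∃ K : ℝ, 0 < K ∧ ∃ LV : ℕ, ∀ L₁ : ℕ, LV ≤ L₁ → ∀ ε : ℝ, 0 < ε → ∃ (β₁ : ℝ) (m₁ : ℕ),
    ∀ (β : ℝ) (m L : ℕ), β₁ ≤ β → m₁ ≤ m → L₁ * M ^ m ≤ L →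
      u β m (L₁ * M ^ m) ≤ K * u β m L + ε

/-- (U_∃h) at fixed data IS its shape applied to Wilson's rescaled correlator table (definitional). -/
theorem femtoLowerBound_iff_shape {G : Type} [Group G] [TopologicalSpace G] [IsTopologicalGroup G]
    [CompactSpace G] [MeasurableSpace G] [BorelSpace G] (r : LatticeRep G) (M : ℕ) :
    FemtoLowerBound r M ↔ FemtoLowerBoundShape (fun β m L => ((M : ℝ) ^ m) ^ 8 *
      latticeConnectedCorr r.ρ β (2 * L + 1) r.curvature.F r.curvature.F (M ^ m)) M :=
  Iff.rfl

/-- (V_slack) at fixed data IS its shape applied to Wilson's rescaled correlator table (definitional). -/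
theorem volumeMonotoneSlack_iff_shape {G : Type} [Group G] [TopologicalSpace G]
    [IsTopologicalGroup G] [CompactSpace G] [MeasurableSpace G] [BorelSpace G] (r : LatticeRep G)
    (M : ℕ) :
    VolumeMonotoneSlack r M ↔ VolumeMonotoneSlackShape (fun β m L => ((M : ℝ) ^ m) ^ 8 *
      latticeConnectedCorr r.ρ β (2 * L + 1) r.curvature.F r.curvature.F (M ^ m)) M :=
  Iff.rfl

/-- (V_slack)'s shape holds for the zero table (no lower-bound content; the core's shape fails for it,
`not_lowerBoundShape_zero`). -/
theorem volumeMonotoneSlackShape_zero (M : ℕ) : VolumeMonotoneSlackShape (fun _ _ _ => 0) M :=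
  ⟨1, one_pos, 0, fun _ _ ε hε => ⟨0, 0, fun _ _ _ _ _ _ => by simpa using hε.le⟩⟩

/-- **The aspect-decaying table** `u(β, m, L) := M^m / (L + 1)` (height `≈ 1 / aspect`): it inhabits the
shape of (U_∃h) for `M ≥ 1` … -/
theorem femtoLowerBoundShape_aspectDecay {M : ℕ} (hM : 1 ≤ M) :
    FemtoLowerBoundShape (fun _ m L => (M : ℝ) ^ m / ((L : ℝ) + 1)) M := by
  refine ⟨0, fun L₁ _ => ⟨1 / ((L₁ : ℝ) + 1), by positivity, fun B m₀ => ⟨m₀, le_rfl, B, le_rfl, ?_⟩⟩⟩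
  have hM1 : (1 : ℝ) ≤ (M : ℝ) ^ m₀ := one_le_pow₀ (by exact_mod_cast hM)
  rw [div_le_div_iff₀ (by positivity) (by positivity)]
  push_cast
  nlinarith [hM1, (Nat.cast_nonneg L₁ : (0 : ℝ) ≤ L₁)]

/-- … while the core's shape FAILS for it: a height that decays with the aspect gives no `θ₀` uniform in
the volume floor `L₀`.  So (U_∃h) is not ≥ `CorrelatorWindowLowerBound`. -/
theorem not_lowerBoundShape_aspectDecay {M : ℕ} (hM : 1 ≤ M) :
    ¬ LowerBoundShape (fun _ m L => (M : ℝ) ^ m / ((L : ℝ) + 1)) M := by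
  rintro ⟨θ₀, hθ₀, h⟩
  -- volume floor `L₀` with `1 / L₀ < θ₀`
  obtain ⟨L₀, hL₀⟩ := exists_nat_gt (1 / θ₀)
  obtain ⟨m, -, L, hL, β, -, hle⟩ := h 0 0 L₀
  have hMm : (0 : ℝ) < (M : ℝ) ^ m := by
    have : (1 : ℝ) ≤ M := by exact_mod_cast hM
    positivity
  have hL' : (L₀ : ℝ) * (M : ℝ) ^ m ≤ L := by exact_mod_cast hL
  have hL₀pos : (0 : ℝ) < L₀ := lt_trans (by positivity) hL₀
  -- `θ₀ ≤ M^m / (L+1) ≤ M^m / (L₀ M^m) = 1 / L₀ < θ₀`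
  have h1 : (M : ℝ) ^ m / ((L : ℝ) + 1) < 1 / L₀ := by
    rw [div_lt_div_iff₀ (by positivity) hL₀pos]
    nlinarith
  have h2 : 1 / (L₀ : ℝ) < θ₀ := by
    rwa [div_lt_iff₀ hL₀pos, mul_comm, ← div_lt_iff₀ hθ₀]
  linarith

end Certificates

end Summit.QuantumFields.YangMills.Theorems.TunedSequenceExists.FixedAspectSplit

end
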